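import Literature.MathematicalPhysics.QuantumFieldTheory.Balaban1983to89.T4RelativeLadder
import Literature.MathematicalPhysics.QuantumFieldTheory.Balaban1983to89.B8Lemma1Lattice

/-!
# `Balaban1983to89.T4RelativeComb` — the RELATIVE axial (staircase-comb) gauge of a pair of NON-ABELIAN lattice
# configurations on a block of `ℤ^d`: tree bonds fixed, interior transverse defects counted, `C_P = (d−1)(L−1)`

CITATION HEADER (lean-in-tree rule 2026-08-18).  Kernel certificate, on CONCRETE `ℤ^d` carriers and for
NON-COMMUTING unit-valued bond variables, of the elementary lattice-geometric count behind two printed sentences of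
the manuscripts under audit by the cell `pub-balaban`: T. Bałaban, *Averaging operations for lattice gauge theories*,
Comm. Math. Phys. **98**, 17–51 (1985) [Balaban1985Averaging] (cell paper B7), pp. 24–25 between (44) and (47), and
T. Bałaban, *Spaces of regular gauge field configurations on a lattice and gauge fixing conditions*, Comm. Math. Phys.
**99**, 75–102 (1985) [Balaban1985RegularSpaces] (cell paper B8), p. 79, proof of Lemma 1, (1.24)–(1.26).  The
quotations below are COPIED from the already certified citation headers of the tree modules `T4AxialChain` (pv12
lineage) and `B8Lemma1Lattice` (b08 lineage, census C-B8-33), where the renders read are named; they are CONTEXT for an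
ELEMENTARY, undisputed step.  The papers are manuscripts UNDER ADJUDICATION by the cell; nothing of them is asserted
here: the file DEFINES a concrete model (unit-valued bond variables on `ℤ^d`, an explicit gauge transformation) and
PROVES [folklore] facts about it; no printed claim enters as a hypothesis.

PRINTED ([Balaban1985Averaging] pp. 24–25): "We assume that a configuration V defined on a unit lattice Ω′ satisfies
|V(∂p) − 1| < α₀, p ⊂ Ω′, (44)" … "let us introduce locally the axial gauge with the initial point y. This means that
we take the contours Γ_{y,x} = [y, (y₁, …, y_{d−1}, x_d)] ∪ … ∪ [(y₁, x₂, …, x_d), x]" … "V₀ = V^{v₀} satisfies the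
conditions V₀(Γ_{y,x}) = 1" … "The conditions V₀(Γ_{y,x}) = 1 imply V₀(x, x + e₁) = 1, |V₀(x, x + e₂) − 1| <
|x₁ − y₁|α₀, |V₀(x, x + e₃) − 1| < (|x₁ − y₁| + |x₂ − y₂|)α₀, …, |V₀(x, x + e_μ) − 1| < (|x₁ − y₁| + … +
|x_{μ−1} − y_{μ−1}|)α₀, μ = 2, …, d, for x in the neighborhood of y." … "|V₀(Γ_{c,x}) − 1| ≦ Σ_{b⊂Γ_{c,x}} |V₀,b − 1|".
PRINTED ([Balaban1985RegularSpaces] p. 79): "Lemma 1. Let V₀, V′V₀ satisfy the condition (1.7) for k = 1 and L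
arbitrary, and let (R(V₀)V′)(Γ_{y,x}) = 1 for x ∈ B(y), |\overline{V′V₀} − V̄₀| < α₁ on Ω₁^{(1)}. (1.24) Then for α₀, α₁
small the configuration V′ is also small, more precisely we have the bound |V′ − 1| < 4d²α₀ + α₁ on Ω₁. (1.25)",
proof: "From (1.22) and the assumptions we have |(∂_{V₀}V′)(p) − 1| ≦ |V₀(∂p) − 1| + |(V′V₀)(∂p) − 1| < 2α₀L⁻². (1.26)
The conditions (R₀V′)(Γ_{y,x}) = 1, x ∈ B(y), imply V′_b = 1 for b ⊂ Γ_{y,x}. This and the above estimate imply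
|V′_b − 1| < (d − 1)(L − 1)2α₀L⁻² for b ⊂ B(y) by the same reasoning as in [3] (between (44) and (46))."
([3] = [Balaban1985Averaging].)

READING — THE MODEL (the cell's, not the papers' words).  Bond variables are units `U x ν ∈ Rˣ` of a normed ring `R`
on the bonds `⟨x, x + e_ν⟩` of `ℤ^d` (`Cfg`); "G-valued" is modelled by `T4RelativeLadder.UnitaryLike` (=
`T4DirectionChart.GUnit`: `‖u‖ ≤ 1 ∧ ‖u⁻¹‖ ≤ 1`), for which conjugation is an isometry on `· − 1`; a gauge
transformation `g : ℤ^d → Rˣ` acts by `(U^g)⟨x,x+e_ν⟩ = g(x)U⟨x,x+e_ν⟩g(x+e_ν)⁻¹` (`gaugeAct`); `V(∂p)` is the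
plaquette word BASED at the corner `x` (`plaq`, = `T4DirectionChart.basePlaq`), which transforms by conjugation at `x`
(`plaq_gaugeAct`).  The PAIR `(V₀, V′V₀)` of Lemma 1 is a pair `(U₀, U₁)` of configurations; the condition
"(R(V₀)V′)(Γ_{y,x}) = 1" is modelled by the RELATIVE axial gauge: the explicit `g = combGauge U₀ U₁ z`, `g(z + k) =
U₀(Γ_{z,z+k})⁻¹·U₁(Γ_{z,z+k})` (ordered holonomies `hol` along the staircase trees of [3] p. 24, the `d`-first
convention and the block `B(z) = z + {0,…,L−1}^d` of `B8Lemma1Lattice`: `mixK`, `InBlock`), in which `U₁^g = U₀` on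
every tree bond; `V′` is the bond-wise defect `W = (U₁^g)·U₀⁻¹` (`defect`); `|· − 1|` is `‖· − 1‖`.

WHAT THE TREE ALREADY HAS.  `T4AxialChain` (pv12): the `ℕ`-indexed comb chain `‖P₀⋯P_{m−1} − 1‖ ≤ m·α₀`
(`norm_oprod_sub_one_le_mul`) and the printed loci above.  `T4RelativeLadder` (t4-ne1p-p1): the `ℕ`-indexed RELATIVE
ladder on abstract data — `relTransport`, the one-square identity `defect_succ`, the chain / ladder / cross-term
inequalities `norm_relStep_sub_one_le`, `norm_triple_sub_one_le`, `norm_conj_sub_le`, the assembled count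
`norm_defect_le_linear : ‖W(n) − 1‖ ≤ n·(p + 2tq)` under a conjugation HYPOTHESIS `hgf` (v4: + differences, block sums,
rebasing — not used here).  `B8Lemma1Lattice` (b08): the
`ℤ^d` geometry (`Site`, `e`, `site`, `mixK`, `InBlock`, …) and Lemma 1 kernel-proved in the ABELIAN (additive) model,
HONEST SCOPE (i): "ABELIAN MODEL ONLY: the non-abelian remainders … are NOT formalised".  `T4BirthChartTransport`
(t4-ne1p-p1): the transport of a birth chart along a relative gauge, with the ladder constant `C_P` a SLOT.

WHAT THIS FILE ADDS (kernel-checked; new sibling leaf, imports `T4RelativeLadder` and `B8Lemma1Lattice` BY NAME,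
nothing above is edited; every theorem [folklore]).
§1 Non-abelian configurations on `ℤ^d`, the gauge action, based plaquettes, and GAUGE COVARIANCE `plaq (U^g) =
   g(x)·plaq U·g(x)⁻¹` (`plaq_gaugeAct`) — the lattice fact that discharges `T4RelativeLadder`'s hypothesis `hgf`.
§2 Tree bonds of the staircase trees (`IsTree k ρ`: coordinates `< ρ` at the corner; `isTree_mixK` = the stages of
   `B8Lemma1Lattice`), the ordered holonomy `hol U z k = U(Γ_{z,z+k})` (well-founded recursion peeling the last bond;
   `hol_succ`: across a tree bond it picks up exactly that bond variable; `hol_mixK_succ`: dictionary with the additive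
   `treeSum`), the RELATIVE AXIAL GAUGE `relGauge`/`combGauge` and its kernel properties: `g(z) = 1`
   (`combGauge_corner`), unitary-like (`unitaryLike_combGauge`), the relative step `relGauge_succ` (=
   `T4RelativeLadder.relTransport_succ` on the lattice), TREE BONDS FIXED `U₁^g = U₀` (`gaugeAct_combGauge_tree` =
   "(R₀V′)(Γ_{y,x}) = 1 … imply V′_b = 1 for b ⊂ Γ_{y,x}"), and the transport bound `‖g(z+k) − 1‖ ≤ |k|₁·ε ≤ d(L−1)ε`
   (`norm_relGauge_sub_one_le`, `norm_combGauge_sub_one_le`; one `norm_relStep_sub_one_le` per path bond).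
§3 The transverse defect `W = (U₁^g)U₀⁻¹`, `W = 1` on tree bonds (`defect_tree`), the RELATIVE STOKES SQUARE on the
   lattice (`defect_rung`: peel the last tree bond `⟨y, y+e_ρ₀⟩`, `ρ₀ = low k < ν`, below the bond; both rails are tree
   bonds, `isTree_add_single`), one rung `‖W⟨y+e_ρ₀,·⟩ − 1‖ ≤ ‖W⟨y,·⟩ − 1‖ + ‖plaq(U₁^g)(y) − plaq U₀(y)‖`
   (`norm_defect_rung_le`), the LADDER LENGTH `ladderLen k ν = Σ_{ρ<ν} k_ρ` with `ladderLen ≤ (d−1)(L−1)` inside the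
   block (`ladderLen_le`), and the MASTER COUNT `‖W⟨z+k, ·+e_ν⟩ − 1‖ ≤ ladderLen·s` for a gauge-fixed per-square bound
   `s` (`norm_defect_sub_one_le_ladderLen`), with `s` discharged from RAW data two ways: FINE `s = p + 2tq`
   (`plaqSup_fine`: raw relative plaquette deviation `p`, base curvature `q`, transport `t`, commutator cross term
   `norm_conj_sub_le`) and CRUDE `s = q₁ + q₀` (`plaqSup_crude`: the two curvatures, the mechanism of (1.26)).
§4 Packaged: `interior_bound_crude` (`‖W − 1‖ ≤ (d−1)(L−1)(q₁ + q₀)` on interior bonds — the printed "(d−1)(L−1)2α₀L⁻²"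
   shape, NON-abelian; lifts `B8Lemma1Lattice` HONEST SCOPE (i) for the interior-bond sentence), `interior_bound_fine`
   (`≤ (d−1)(L−1)(p + 2·d(L−1)ε·q)`: LINEAR ladder constant `C_P = (d−1)(L−1)`, second order in transport × curvature),
   `axial_bound` / `axial_tree` (the flat case `U₀ ≡ 1` = the [3] p. 24 sentence with `m = Σ_{κ<μ}|x_κ − y_κ|`), and
   `relative_comb_gauge` (∃ unitary-like `g`, `g(z) = 1`, tree bonds fixed, `‖g − 1‖ ≤ d(L−1)ε` on `B(z)`, interior
   defects `≤ (d−1)(L−1)(p + 2d(L−1)εq)`) — the sup-norm, one-block, lattice-geometric part of the cell's located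
   obligation O-G1′ (GAPS G-ne1p1-1, "C_P(R) = O(R)": here `C_P = (d−1)(side − 1)`).
§5 Non-vacuity (flat pair: hypotheses inhabited, conclusion forces `W = 1`).

HONEST SCOPE / NOT TYPED.  (i) ONE BLOCK, SUP NORM: no Hölder / derivative norms of the defect (record (O2a)), no
patching of the comb gauges of neighbouring blocks or `M`-cubes into one gauge (record (O2b) proper — the crossing-bond
and average part "(1.25) for an arbitrary bond b" of Lemma 1 involves the non-linear average and is NOT treated; its
abelian model is `B8Lemma1Lattice` §3–§4), no curvature of a moved background (O2c).  (ii) "G-valued" = `UnitaryLike`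
for BOTH configurations; for a COMPLEX (Gᶜ-valued, non-unitary) pair the conjugation isometry fails and every rung /
step acquires the factor `‖u‖‖u⁻¹‖` of `T4AxialChain.norm_conj_sub_one_le` — the complex window of G-ne1p1-1 is NOT
covered here.  (iii) `W` is a unit of `R`; no logarithm `(1/i) log W` is taken and no Lie-algebra norm `N_j(𝐀⊥)` is
defined.  (iv) Corner-anchored blocks and `d`-first staircases are the [3] p. 24 convention as read in `B8Lemma1Lattice`
(its scope note (iii)); the printed sentence lists the coordinates in the opposite order, a relabelling.  (v) The
per-square input is taken in GAUGE-FIXED form `‖plaq(U₁^g) − plaq U₀‖ ≤ s` by the master count and discharged from raw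
bounds by `plaqSup_fine` / `plaqSup_crude`; no claim is made about which raw bounds Bałaban's spaces supply.  (vi) NO
statement about Bałaban's renormalization transformations, windows (3.31)/(3.32), or the regularity spaces is asserted;
value = kernel bookkeeping of a finite group identity and triangle inequalities on concrete carriers + a located-gap
narrowing (the geometric half of O-G1′ in sup norm), NOT summit progress.  Unit `b2b-balaban-pv04` gen 13 (journal
claim T4-O3.E-NE1′-OG1′-COMB*).
-/

namespace Literature.MathematicalPhysics.QuantumFieldTheory.Balaban1983to89.T4RelativeComb

open Finset
open B8Lemma1Lattice (e site site_add_single mixK mixK_step InBlock inBlock_site_iff exists_offset_of_inBlock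
  lt_of_add_single)
open T4RelativeLadder (UnitaryLike norm_conj_sub_one_eq norm_relStep_sub_one_le norm_conj_sub_le
  norm_triple_sub_one_le)

variable {R : Type*} [NormedRing R] {d : ℕ}

/-! ## §1  Unit-valued lattice configurations, gauge action, based plaquettes, covariance -/

/-- [folklore] Sites of `ℤ^d` — the SAME carrier as `B8Lemma1Lattice.Site d = (Fin d → ℤ)` (definitionally; re-declared
in this namespace only because the unrelated `QuantumFieldTheory.Site (d L : ℕ)` of an ancestor namespace would
otherwise capture the bare name), so that every `B8Lemma1Lattice` lemma on sites / offsets / blocks applies verbatim. -/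
abbrev Site (d : ℕ) : Type := Fin d → ℤ

example (d : ℕ) : Site d = B8Lemma1Lattice.Site d := rfl

/-- [folklore] NON-ABELIAN bond configurations on `ℤ^d`: `U x ν ∈ Rˣ` is the variable of the bond `⟨x, x + e_ν⟩`
(its inverse on the reversed bond); `R` any normed ring (intended: a matrix algebra containing `G ⊂ Gᶜ`). -/
abbrev Cfg (d : ℕ) (R : Type*) [NormedRing R] : Type _ := Site d → Fin d → Rˣ

/-- [folklore] The gauge action of `g : ℤ^d → Rˣ` on bond variables: `(U^g)⟨x, x+e_ν⟩ = g(x)·U⟨x, x+e_ν⟩·g(x+e_ν)⁻¹`. -/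
def gaugeAct (g : Site d → Rˣ) (U : Cfg d R) : Cfg d R := fun x ν => g x * U x ν * (g (x + e ν))⁻¹

/-- [folklore] The plaquette variable of `p = (x; ρ, ν)` BASED at `x`, read "along `e_ρ`, along `e_ν`, back along `e_ρ`,
back along `e_ν`": `U⟨x,x+e_ρ⟩·U⟨x+e_ρ,x+e_ρ+e_ν⟩·U⟨x+e_ν,x+e_ν+e_ρ⟩⁻¹·U⟨x,x+e_ν⟩⁻¹` (= `T4DirectionChart.basePlaq`, the
orientation of `T4RelativeLadder.plaq` with `hb = U⟨x,x+e_ρ⟩`, `ht = U⟨x+e_ν,·⟩`, rungs `U⟨x,x+e_ν⟩`, `U⟨x+e_ρ,·⟩`; the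
additive model of this word is `B8Lemma1Lattice.plaq`). -/
def plaq (U : Cfg d R) (x : Site d) (ρ ν : Fin d) : Rˣ :=
  U x ρ * U (x + e ρ) ν * (U (x + e ν) ρ)⁻¹ * (U x ν)⁻¹

/-- [folklore] Dictionary: `plaq` is the chart's `basePlaq` on the four bond variables of the lattice square. -/
theorem plaq_eq_basePlaq (U : Cfg d R) (x : Site d) (ρ ν : Fin d) :
    plaq U x ρ ν = T4DirectionChart.basePlaq (U x ρ) (U (x + e ρ) ν) (U (x + e ν) ρ) (U x ν) := rfl

/-- [folklore] GAUGE COVARIANCE of based plaquettes: `plaq (U^g) (x; ρ, ν) = g(x)·plaq U (x; ρ, ν)·g(x)⁻¹` — the inner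
gauge factors cancel around the square.  This is the lattice fact behind hypothesis `hgf` of
`T4RelativeLadder.norm_defect_le_linear` ("based holonomies transform by conjugation at the base point"). -/
theorem plaq_gaugeAct (g : Site d → Rˣ) (U : Cfg d R) (x : Site d) (ρ ν : Fin d) :
    plaq (gaugeAct g U) x ρ ν = g x * plaq U x ρ ν * (g x)⁻¹ := by
  simp only [plaq, gaugeAct, add_right_comm x (e ν) (e ρ)]
  group

/-- [folklore] Gauge transforms of unitary-like configurations by unitary-like gauges are unitary-like. -/
theorem unitaryLike_gaugeAct {g : Site d → Rˣ} {U : Cfg d R} (hg : ∀ x, UnitaryLike (g x))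
    (hU : ∀ x ν, UnitaryLike (U x ν)) (x : Site d) (ν : Fin d) : UnitaryLike (gaugeAct g U x ν) :=
  ((hg x).mul (hU x ν)).mul (hg _).inv

/-- [folklore] Plaquette variables of a unitary-like configuration are unitary-like. -/
theorem unitaryLike_plaq {U : Cfg d R} (hU : ∀ x ν, UnitaryLike (U x ν)) (x : Site d) (ρ ν : Fin d) :
    UnitaryLike (plaq U x ρ ν) :=
  (((hU x ρ).mul (hU _ ν)).mul (hU _ ρ).inv).mul (hU x ν).inv

/-! ## §2  The staircase tree from a corner: tree bonds, ordered holonomy, the relative axial gauge -/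

/-- [cite: Balaban1985Averaging, (44)–(47) pp. 24–25] TREE BONDS of the staircase trees `Γ_{z,x}` ("Γ_{y,x} =
[y, (y₁, …, y_{d−1}, x_d)] ∪ … ∪ [(y₁, x₂, …, x_d), x]", coordinate `d` first — the convention of
`B8Lemma1Lattice.mixK`): the bond `⟨z + k, z + k + e_ρ⟩` lies on a tree `Γ_{z,x}` iff the offset `k` has all coordinates
of index `< ρ` equal to `0` (in particular every `e₁`-bond: "V₀(Γ_{y,x}) = 1 imply V₀(x, x + e₁) = 1"). -/
def IsTree (k : Fin d → ℕ) (ρ : Fin d) : Prop := ∀ κ : Fin d, (κ : ℕ) < ρ → k κ = 0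

/-- [folklore] The sites of stage `ρ` of `B8Lemma1Lattice`'s staircase carry tree bonds in direction `ρ`. -/
theorem isTree_mixK (k : Fin d → ℕ) (ρ : Fin d) (j : ℕ) : IsTree (mixK k ρ j) ρ := by
  intro κ hκ; simp [mixK, hκ]

/-- [folklore] The corner offset carries tree bonds in every direction. -/
theorem isTree_zero (ρ : Fin d) : IsTree (0 : Fin d → ℕ) ρ := fun _ _ => rfl

/-- [folklore] A tree bond translated in a LATER direction `ν > ρ` is again a tree bond (the two rails of a ladder
square are tree bonds). -/
theorem isTree_add_single {k : Fin d → ℕ} {ρ ν : Fin d} (hk : IsTree k ρ) (hν : (ρ : ℕ) < ν) :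
    IsTree (k + Pi.single ν 1) ρ := by
  intro κ hκ
  have hκν : κ ≠ ν := by intro h; subst h; omega
  simp [hk κ hκ, hκν]

/-- [folklore] The LOWEST coordinate direction in which the offset `k ≠ 0` is non-zero: the direction of the LAST bond
of the tree path `Γ_{z, z+k}` (stages run from coordinate `d` down to coordinate `1`). -/
def low (k : Fin d → ℕ) (h : ∃ ρ, k ρ ≠ 0) : Fin d :=
  (univ.filter fun ρ => k ρ ≠ 0).min' (by obtain ⟨ρ, hρ⟩ := h; exact ⟨ρ, by simpa using hρ⟩)

/-- [folklore] `low k` lies in the support of `k`. -/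
theorem low_mem (k : Fin d → ℕ) (h : ∃ ρ, k ρ ≠ 0) : low k h ∈ univ.filter fun ρ => k ρ ≠ 0 :=
  Finset.min'_mem _ _

/-- [folklore] `k (low k) ≠ 0`. -/
theorem low_ne_zero (k : Fin d → ℕ) (h : ∃ ρ, k ρ ≠ 0) : k (low k h) ≠ 0 := by
  simpa using low_mem k h

/-- [folklore] `low k` is below every non-zero coordinate. -/
theorem low_le (k : Fin d → ℕ) (h : ∃ ρ, k ρ ≠ 0) {κ : Fin d} (hκ : k κ ≠ 0) : low k h ≤ κ :=
  Finset.min'_le _ _ (by simpa using hκ)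

/-- [folklore] The last bond of the tree path is a tree bond: all coordinates below `low k` vanish. -/
theorem isTree_low (k : Fin d → ℕ) (h : ∃ ρ, k ρ ≠ 0) : IsTree k (low k h) := by
  intro κ hκ
  by_contra hne
  exact absurd (low_le k h hne) (not_le.2 (show κ < low k h from hκ))

/-- [folklore] The offset of the foot of the last bond of `Γ_{z, z+k}`: one step back in direction `low k`. -/
def pred' (k : Fin d → ℕ) (h : ∃ ρ, k ρ ≠ 0) : Fin d → ℕ := k - Pi.single (low k h) 1

/-- [folklore] Coordinates of `pred' k`. -/
theorem pred'_apply (k : Fin d → ℕ) (h : ∃ ρ, k ρ ≠ 0) (κ : Fin d) :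
    pred' k h κ = k κ - (Pi.single (low k h) (1 : ℕ) : Fin d → ℕ) κ := rfl

/-- [folklore] `pred' k ≤ k` coordinate-wise (the tree path to `pred' k` stays in the block). -/
theorem pred'_le (k : Fin d → ℕ) (h : ∃ ρ, k ρ ≠ 0) (κ : Fin d) : pred' k h κ ≤ k κ := Nat.sub_le _ _

/-- [folklore] `pred' k` agrees with `k` off the direction `low k`. -/
theorem pred'_apply_of_ne (k : Fin d → ℕ) (h : ∃ ρ, k ρ ≠ 0) {κ : Fin d} (hκ : κ ≠ low k h) :
    pred' k h κ = k κ := by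
  simp [pred'_apply, Pi.single_eq_of_ne hκ]

/-- [folklore] `pred' k + e_{low k} = k`. -/
theorem pred'_add_single (k : Fin d → ℕ) (h : ∃ ρ, k ρ ≠ 0) : pred' k h + Pi.single (low k h) 1 = k := by
  funext κ
  have hne := low_ne_zero k h
  by_cases hκ : κ = low k h
  · subst hκ; simp only [Pi.add_apply, pred'_apply, Pi.single_eq_same]; omega
  · simp [pred'_apply, Pi.single_eq_of_ne hκ]

/-- [folklore] The foot of the last bond carries a tree bond in direction `low k`. -/
theorem isTree_pred' (k : Fin d → ℕ) (h : ∃ ρ, k ρ ≠ 0) : IsTree (pred' k h) (low k h) := by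
  intro κ hκ
  have := isTree_low k h κ hκ
  have := pred'_le k h κ
  omega

/-- [folklore] The path to `pred' k` is one bond shorter: `Σ k = Σ pred' k + 1`. -/
theorem sum_eq_sum_pred'_succ (k : Fin d → ℕ) (h : ∃ ρ, k ρ ≠ 0) : ∑ ρ, k ρ = ∑ ρ, pred' k h ρ + 1 := by
  conv_lhs => rw [← pred'_add_single k h]
  simp only [Pi.add_apply]
  rw [Finset.sum_add_distrib, Finset.sum_pi_single']
  simp

/-- [folklore] The recursion measure decreases: `Σ pred' k < Σ k`. -/
theorem sum_pred'_lt (k : Fin d → ℕ) (h : ∃ ρ, k ρ ≠ 0) : ∑ ρ, pred' k h ρ < ∑ ρ, k ρ := by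
  rw [sum_eq_sum_pred'_succ k h]; exact Nat.lt_succ_self _

/-- [cite: Balaban1985Averaging, (44)–(47) pp. 24–25] The ORDERED HOLONOMY (parallel transporter) `U(Γ_{z, z+k})` of a
configuration along the staircase tree from the corner `z` to `z + k` — the product of the bond variables in path order
(stage of coordinate `d` first, …, coordinate `1` last; within a stage away from the corner), defined by peeling off the
LAST bond: `U(Γ_{z,z+k}) = U(Γ_{z,z+k−e_ρ₀})·U⟨z+k−e_ρ₀, z+k⟩`, `ρ₀ = low k`. [folklore] -/
def hol (U : Cfg d R) (z : Site d) (k : Fin d → ℕ) : Rˣ :=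
  if h : ∃ ρ, k ρ ≠ 0 then hol U z (pred' k h) * U (site z (pred' k h)) (low k h) else 1
termination_by ∑ ρ, k ρ
decreasing_by exact sum_pred'_lt k h

/-- [folklore] The empty path: `U(Γ_{z,z}) = 1`. -/
theorem hol_zero (U : Cfg d R) (z : Site d) : hol U z 0 = 1 := by
  rw [hol, dif_neg]; simp

/-- [folklore] THE EXTENSION RULE: across a TREE bond `⟨z+k, z+k+e_ρ⟩` (`IsTree k ρ`) the holonomy picks up exactly that
bond variable: `U(Γ_{z,z+k+e_ρ}) = U(Γ_{z,z+k})·U⟨z+k, z+k+e_ρ⟩`. -/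
theorem hol_succ (U : Cfg d R) (z : Site d) {k : Fin d → ℕ} {ρ : Fin d} (hk : IsTree k ρ) :
    hol U z (k + Pi.single ρ 1) = hol U z k * U (site z k) ρ := by
  have h : ∃ ρ', (k + Pi.single ρ 1 : Fin d → ℕ) ρ' ≠ 0 := ⟨ρ, by simp⟩
  have hlow : low (k + Pi.single ρ 1) h = ρ := by
    apply le_antisymm (low_le _ h (by simp))
    by_contra hlt
    have hlt' : ((low (k + Pi.single ρ 1) h : Fin d) : ℕ) < ρ := not_le.1 hlt
    have h0 : k (low (k + Pi.single ρ 1) h) = 0 := hk _ hlt'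
    have hne : low (k + Pi.single ρ 1) h ≠ ρ := fun heq => by rw [heq] at hlt'; exact lt_irrefl _ hlt'
    apply low_ne_zero (k + Pi.single ρ 1) h
    simp [h0, Pi.single_eq_of_ne hne]
  have hpred : pred' (k + Pi.single ρ 1) h = k := by
    funext κ
    rw [pred'_apply, hlow, Pi.add_apply]
    omega
  conv_lhs => rw [hol, dif_pos h]
  rw [hpred, hlow]

/-- [folklore] Dictionary with `B8Lemma1Lattice`'s stages: along stage `ρ` of `Γ_{z,x}` the holonomy grows one bond
per site, `U(Γ to mixK k ρ (j+1)) = U(Γ to mixK k ρ j)·U⟨site z (mixK k ρ j), · + e_ρ⟩` — so `hol` is the ordered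
product of `U` over exactly the bonds summed by `B8Lemma1Lattice.treeSum` in the additive model. -/
theorem hol_mixK_succ (U : Cfg d R) (z : Site d) (k : Fin d → ℕ) (ρ : Fin d) (j : ℕ) :
    hol U z (mixK k ρ (j + 1)) = hol U z (mixK k ρ j) * U (site z (mixK k ρ j)) ρ := by
  rw [mixK_step]; exact hol_succ U z (isTree_mixK k ρ j)

/-- [folklore] Holonomies of unitary-like configurations are unitary-like. -/
theorem unitaryLike_hol [NormOneClass R] {U : Cfg d R} (hU : ∀ x ν, UnitaryLike (U x ν)) (z : Site d) :
    ∀ k, UnitaryLike (hol U z k) := by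
  suffices H : ∀ n (k : Fin d → ℕ), ∑ ρ, k ρ = n → UnitaryLike (hol U z k) from fun k => H _ k rfl
  intro n
  induction n with
  | zero =>
      intro k hk
      have hk0 : k = 0 := by
        funext κ; exact (Finset.sum_eq_zero_iff.1 hk) κ (mem_univ κ)
      subst hk0; rw [hol_zero]; exact UnitaryLike.one
  | succ n ih =>
      intro k hk
      obtain ⟨ρ₁, -, hρ₁⟩ : ∃ ρ ∈ (univ : Finset (Fin d)), k ρ ≠ 0 :=
        Finset.exists_ne_zero_of_sum_ne_zero (by omega)
      have h : ∃ ρ, k ρ ≠ 0 := ⟨ρ₁, hρ₁⟩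
      have hn : ∑ ρ, pred' k h ρ = n := by have := sum_eq_sum_pred'_succ k h; omega
      have e1 : hol U z k = hol U z (pred' k h) * U (site z (pred' k h)) (low k h) := by
        conv_lhs => rw [← pred'_add_single k h]
        exact hol_succ U z (isTree_pred' k h)
      rw [e1]; exact (ih _ hn).mul (hU _ _)

/-- [cite: Balaban1985RegularSpaces, Lemma 1 (1.24)–(1.26) p. 79] THE RELATIVE AXIAL GAUGE of the pair `(U₀, U₁)` on
the block with corner `z`, as a function of the offset: `u(z+k) := U₀(Γ_{z,z+k})⁻¹·U₁(Γ_{z,z+k})` — chosen so that `U₁^u`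
AGREES WITH `U₀` on every tree bond (`gaugeAct_combGauge_tree`; the relative form "(R(V₀)V′)(Γ_{y,x}) = 1 for
x ∈ B(y)" of (1.24); for `U₀ ≡ 1` it is the axial gauge "V₀(Γ_{y,x}) = 1" of [Balaban1985Averaging] p. 24).  The word
is the lattice instance of `T4RelativeLadder.relTransport` (`relGauge_succ`). [folklore] -/
def relGauge (U₀ U₁ : Cfg d R) (z : Site d) (k : Fin d → ℕ) : Rˣ := (hol U₀ z k)⁻¹ * hol U₁ z k

/-- [folklore] `u(z) = 1`. -/
theorem relGauge_zero (U₀ U₁ : Cfg d R) (z : Site d) : relGauge U₀ U₁ z 0 = 1 := by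
  simp [relGauge, hol_zero]

/-- [folklore] THE RELATIVE STEP across a tree bond: `u(z+k+e_ρ) = U₀⟨z+k,·⟩⁻¹·u(z+k)·U₁⟨z+k,·⟩`
(= `T4RelativeLadder.relTransport_succ` on the lattice). -/
theorem relGauge_succ (U₀ U₁ : Cfg d R) (z : Site d) {k : Fin d → ℕ} {ρ : Fin d} (hk : IsTree k ρ) :
    relGauge U₀ U₁ z (k + Pi.single ρ 1) = (U₀ (site z k) ρ)⁻¹ * relGauge U₀ U₁ z k * U₁ (site z k) ρ := by
  simp only [relGauge, hol_succ _ _ hk, mul_inv_rev, mul_assoc]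

/-- [folklore] The relative gauge of unitary-like configurations is unitary-like. -/
theorem unitaryLike_relGauge [NormOneClass R] {U₀ U₁ : Cfg d R} (hU₀ : ∀ x ν, UnitaryLike (U₀ x ν))
    (hU₁ : ∀ x ν, UnitaryLike (U₁ x ν)) (z : Site d) (k : Fin d → ℕ) : UnitaryLike (relGauge U₀ U₁ z k) :=
  (unitaryLike_hol hU₀ z k).inv.mul (unitaryLike_hol hU₁ z k)

/-- [folklore] The offset of a site from the corner (junk outside the positive orthant of `z`, never used there). -/
def toOff (z x : Site d) : Fin d → ℕ := fun κ => (x κ - z κ).toNat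

/-- [folklore] The offset of `site z k` is `k`. -/
theorem toOff_site (z : Site d) (k : Fin d → ℕ) : toOff z (site z k) = k := by
  funext κ; simp [toOff, site]

/-- [folklore] The offset of the corner is `0`. -/
theorem toOff_self (z : Site d) : toOff z z = 0 := by
  funext κ; simp [toOff]

/-- [folklore] THE COMB GAUGE as a function on sites: `g(x) = u(x − z)`. -/
def combGauge (U₀ U₁ : Cfg d R) (z : Site d) : Site d → Rˣ := fun x => relGauge U₀ U₁ z (toOff z x)

/-- [folklore] The comb gauge at `site z k` is the relative gauge at offset `k`. -/
theorem combGauge_site (U₀ U₁ : Cfg d R) (z : Site d) (k : Fin d → ℕ) :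
    combGauge U₀ U₁ z (site z k) = relGauge U₀ U₁ z k := by
  simp [combGauge, toOff_site]

/-- [folklore] `g(z) = 1`: the comb gauge is the identity at the corner. -/
theorem combGauge_corner (U₀ U₁ : Cfg d R) (z : Site d) : combGauge U₀ U₁ z z = 1 := by
  simp [combGauge, toOff_self, relGauge_zero]

/-- [folklore] The comb gauge is unitary-like everywhere. -/
theorem unitaryLike_combGauge [NormOneClass R] {U₀ U₁ : Cfg d R} (hU₀ : ∀ x ν, UnitaryLike (U₀ x ν))
    (hU₁ : ∀ x ν, UnitaryLike (U₁ x ν)) (z x : Site d) : UnitaryLike (combGauge U₀ U₁ z x) :=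
  unitaryLike_relGauge hU₀ hU₁ z _

/-- [cite: Balaban1985RegularSpaces, Lemma 1 (1.24)–(1.26) p. 79] TREE BONDS ARE FIXED: in the comb gauge
configuration `1` coincides with configuration `0` on every tree bond, `(U₁^g)⟨z+k, z+k+e_ρ⟩ = U₀⟨z+k, z+k+e_ρ⟩` for
`IsTree k ρ` — "The conditions (R₀V′)(Γ_{y,x}) = 1, x ∈ B(y), imply V′_b = 1 for b ⊂ Γ_{y,x}" with `V′ = U₁^g·U₀⁻¹`
bond-wise. [folklore] -/
theorem gaugeAct_combGauge_tree (U₀ U₁ : Cfg d R) (z : Site d) {k : Fin d → ℕ} {ρ : Fin d} (hk : IsTree k ρ) :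
    gaugeAct (combGauge U₀ U₁ z) U₁ (site z k) ρ = U₀ (site z k) ρ := by
  simp only [gaugeAct, ← site_add_single, combGauge_site, relGauge_succ _ _ _ hk]
  group

/-- [cite: Balaban1985Averaging, (44)–(47) pp. 24–25] THE RELATIVE TRANSPORT BOUND, LINEAR in the path length:
`‖u(z+k) − 1‖ ≤ |k|₁·ε` when the two configurations differ by at most `ε` on the bonds of the block `B(z)` (`U₀`
unitary-like, `‖U₁‖ ≤ 1`) — the relative form of "|V₀(Γ_{c,x}) − 1| ≦ Σ_{b⊂Γ_{c,x}} |V₀,b − 1|"; one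
`T4RelativeLadder.norm_relStep_sub_one_le` per bond. [folklore] -/
theorem norm_relGauge_sub_one_le [NormOneClass R] {U₀ U₁ : Cfg d R} {z : Site d} {L : ℕ} {ε : ℝ}
    (hU₀ : ∀ x ν, UnitaryLike (U₀ x ν)) (hU₁ : ∀ x ν, ‖(U₁ x ν : R)‖ ≤ 1)
    (hε : ∀ x ν, InBlock L z x → InBlock L z (x + e ν) → ‖(U₁ x ν : R) - U₀ x ν‖ ≤ ε) :
    ∀ k : Fin d → ℕ, (∀ κ, k κ < L) → ‖(relGauge U₀ U₁ z k : R) - 1‖ ≤ ((∑ ρ, k ρ : ℕ) : ℝ) * ε := by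
  suffices H : ∀ n (k : Fin d → ℕ), ∑ ρ, k ρ = n → (∀ κ, k κ < L) →
      ‖(relGauge U₀ U₁ z k : R) - 1‖ ≤ (n : ℝ) * ε from fun k hk => H _ k rfl hk
  intro n
  induction n with
  | zero =>
      intro k hk _
      have hk0 : k = 0 := by
        funext κ; exact (Finset.sum_eq_zero_iff.1 hk) κ (mem_univ κ)
      subst hk0; simp [relGauge_zero]
  | succ n ih =>
      intro k hk hkL
      obtain ⟨ρ₁, -, hρ₁⟩ : ∃ ρ ∈ (univ : Finset (Fin d)), k ρ ≠ 0 :=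
        Finset.exists_ne_zero_of_sum_ne_zero (by omega)
      have h : ∃ ρ, k ρ ≠ 0 := ⟨ρ₁, hρ₁⟩
      have hn : ∑ ρ, pred' k h ρ = n := by have := sum_eq_sum_pred'_succ k h; omega
      have hpL : ∀ κ, pred' k h κ < L := fun κ => (pred'_le k h κ).trans_lt (hkL κ)
      have e1 : relGauge U₀ U₁ z k =
          (U₀ (site z (pred' k h)) (low k h))⁻¹ * relGauge U₀ U₁ z (pred' k h) * U₁ (site z (pred' k h)) (low k h) := by
        conv_lhs => rw [← pred'_add_single k h]
        exact relGauge_succ U₀ U₁ z (isTree_pred' k h)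
      have hb : ‖(U₁ (site z (pred' k h)) (low k h) : R) - U₀ (site z (pred' k h)) (low k h)‖ ≤ ε := by
        apply hε
        · exact (inBlock_site_iff L z _).2 hpL
        · rw [← site_add_single, pred'_add_single]; exact (inBlock_site_iff L z _).2 hkL
      rw [e1, Units.val_mul, Units.val_mul]
      calc _ ≤ ‖(relGauge U₀ U₁ z (pred' k h) : R) - 1‖
              + ‖(U₁ (site z (pred' k h)) (low k h) : R) - U₀ (site z (pred' k h)) (low k h)‖ :=
            norm_relStep_sub_one_le (hU₀ _ _) (hU₁ _ _) _
        _ ≤ (n : ℝ) * ε + ε := add_le_add (ih _ hn hpL) hb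
        _ = ((n + 1 : ℕ) : ℝ) * ε := by push_cast; ring

/-! ## §3  Interior transverse defects: one relative Stokes square per tree bond of the ladder -/

/-- [folklore] THE TRANSVERSE DEFECT of the bond `⟨x, x+e_ν⟩` in the comb gauge: `W⟨x,x+e_ν⟩ := (U₁^g)⟨x,x+e_ν⟩·
U₀⟨x,x+e_ν⟩⁻¹`, i.e. `U₁^g = W·U₀` bond-wise (`W = 1` on tree bonds; on the other bonds of the block `W` is the
exponentiated transverse remainder "exp(iξ𝐀⊥)" of the cell's record, here only as a unit of `R`). -/
def defect (U₀ U₁ : Cfg d R) (z x : Site d) (ν : Fin d) : Rˣ :=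
  gaugeAct (combGauge U₀ U₁ z) U₁ x ν * (U₀ x ν)⁻¹

/-- [folklore] `W = 1` on tree bonds. -/
theorem defect_tree (U₀ U₁ : Cfg d R) (z : Site d) {k : Fin d → ℕ} {ν : Fin d} (hk : IsTree k ν) :
    defect U₀ U₁ z (site z k) ν = 1 := by
  rw [defect, gaugeAct_combGauge_tree U₀ U₁ z hk, mul_inv_cancel]

/-- [folklore] The pure group identity of ONE LADDER SQUARE whose two rails are fixed (`T4RelativeLadder.defect_succ`
with the lattice names): rails `a` (bottom) and `c` (top) common to both configurations, rungs `Vy, Vx` resp. `Uy, Ux`. -/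
theorem rung_identity {G : Type*} [Group G] (a c Vx Vy Ux Uy : G) :
    Vx * Ux⁻¹ = a⁻¹ * ((a * Vx * c⁻¹ * Vy⁻¹) * (Vy * Uy⁻¹) * (a * Ux * c⁻¹ * Uy⁻¹)⁻¹) * a := by
  group

/-- [folklore] THE RELATIVE STOKES SQUARE on the lattice: for `k ≠ 0` with `ρ₀ = low k < ν`, writing `y = z + pred' k`
(so `z + k = y + e_ρ₀` and both rails `⟨y, y+e_ρ₀⟩`, `⟨y+e_ν, y+e_ν+e_ρ₀⟩` are tree bonds, fixed by the comb gauge),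
`W⟨z+k, ·+e_ν⟩ = U₀⟨y,y+e_ρ₀⟩⁻¹·( plaq(U₁^g)(y;ρ₀,ν) · W⟨y, y+e_ν⟩ · plaq U₀ (y;ρ₀,ν)⁻¹ )·U₀⟨y,y+e_ρ₀⟩`. -/
theorem defect_rung (U₀ U₁ : Cfg d R) (z : Site d) (k : Fin d → ℕ) (h : ∃ ρ, k ρ ≠ 0) (ν : Fin d)
    (hν : ((low k h : Fin d) : ℕ) < ν) :
    defect U₀ U₁ z (site z k) ν =
      (U₀ (site z (pred' k h)) (low k h))⁻¹ *
        (plaq (gaugeAct (combGauge U₀ U₁ z) U₁) (site z (pred' k h)) (low k h) ν *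
          defect U₀ U₁ z (site z (pred' k h)) ν *
          (plaq U₀ (site z (pred' k h)) (low k h) ν)⁻¹) *
      U₀ (site z (pred' k h)) (low k h) := by
  have hx : site z k = site z (pred' k h) + e (low k h) := by
    rw [← site_add_single, pred'_add_single]
  have ht1 : gaugeAct (combGauge U₀ U₁ z) U₁ (site z (pred' k h)) (low k h) = U₀ (site z (pred' k h)) (low k h) :=
    gaugeAct_combGauge_tree U₀ U₁ z (isTree_pred' k h)
  have ht2 : gaugeAct (combGauge U₀ U₁ z) U₁ (site z (pred' k h) + e ν) (low k h) =
      U₀ (site z (pred' k h) + e ν) (low k h) := by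
    rw [← site_add_single]
    exact gaugeAct_combGauge_tree U₀ U₁ z (isTree_add_single (isTree_pred' k h) hν)
  rw [hx]
  simp only [defect, plaq]
  rw [ht1, ht2]
  exact rung_identity _ _ _ _ _ _

/-- [folklore] ONE RUNG on the lattice: `‖W⟨z+k,·⟩ − 1‖ ≤ ‖W⟨y,·⟩ − 1‖ + ‖plaq(U₁^g)(y;ρ₀,ν) − plaq U₀(y;ρ₀,ν)‖`
(conjugation by the unitary-like rail is an isometry on `· − 1`, `T4RelativeLadder.norm_conj_sub_one_eq`; then
`‖P₁WP₀⁻¹ − 1‖ ≤ ‖W − 1‖ + ‖P₁ − P₀‖`, `T4RelativeLadder.norm_triple_sub_one_le`, both BY NAME). -/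
theorem norm_defect_rung_le [NormOneClass R] {U₀ U₁ : Cfg d R} (hU₀ : ∀ x ν, UnitaryLike (U₀ x ν))
    (hU₁ : ∀ x ν, UnitaryLike (U₁ x ν)) (z : Site d) (k : Fin d → ℕ) (h : ∃ ρ, k ρ ≠ 0) (ν : Fin d)
    (hν : ((low k h : Fin d) : ℕ) < ν) :
    ‖(defect U₀ U₁ z (site z k) ν : R) - 1‖ ≤
      ‖(defect U₀ U₁ z (site z (pred' k h)) ν : R) - 1‖ +
        ‖(plaq (gaugeAct (combGauge U₀ U₁ z) U₁) (site z (pred' k h)) (low k h) ν : R) -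
          plaq U₀ (site z (pred' k h)) (low k h) ν‖ := by
  have hg := unitaryLike_combGauge hU₀ hU₁ z
  set a : Rˣ := U₀ (site z (pred' k h)) (low k h) with ha
  set P₁ : Rˣ := plaq (gaugeAct (combGauge U₀ U₁ z) U₁) (site z (pred' k h)) (low k h) ν with hP₁
  set P₀ : Rˣ := plaq U₀ (site z (pred' k h)) (low k h) ν with hP₀
  set W : Rˣ := defect U₀ U₁ z (site z (pred' k h)) ν with hW
  have uP₁ : UnitaryLike P₁ := unitaryLike_plaq (unitaryLike_gaugeAct hg hU₁) _ _ _
  have uP₀ : UnitaryLike P₀ := unitaryLike_plaq hU₀ _ _ _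
  have e1 : (defect U₀ U₁ z (site z k) ν : R) = ((a⁻¹ : Rˣ) : R) * ((P₁ : R) * W * ↑P₀⁻¹) * ↑(a⁻¹)⁻¹ := by
    rw [defect_rung U₀ U₁ z k h ν hν, inv_inv]; simp [ha, hP₁, hP₀, hW, mul_assoc]
  rw [e1, norm_conj_sub_one_eq (hU₀ _ _).inv]
  exact norm_triple_sub_one_le uP₁ uP₀ _

/-- [cite: Balaban1985Averaging, (44)–(47) pp. 24–25] THE LADDER LENGTH of the bond `⟨z+k, z+k+e_ν⟩`: one square per
tree bond of a stage `ρ < ν` of `Γ_{z,z+k}`, `Σ_{ρ<ν} k_ρ` squares ("|V₀(x, x + e_μ) − 1| < (|x₁ − y₁| + … +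
|x_{μ−1} − y_{μ−1}|)α₀"; the index set of `B8Lemma1Lattice.ladder`). [folklore] -/
def ladderLen (k : Fin d → ℕ) (ν : Fin d) : ℕ := ∑ ρ ∈ univ.filter (fun ρ : Fin d => (ρ : ℕ) < ν), k ρ

/-- [folklore] A bond with empty ladder is a tree bond. -/
theorem isTree_of_ladderLen_eq_zero {k : Fin d → ℕ} {ν : Fin d} (h : ladderLen k ν = 0) : IsTree k ν := by
  intro κ hκ
  exact (Finset.sum_eq_zero_iff.1 h) κ (Finset.mem_filter.2 ⟨Finset.mem_univ _, hκ⟩)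

/-- [folklore] Peeling the last tree bond below `ν` shortens the ladder by one square. -/
theorem ladderLen_eq_succ (k : Fin d → ℕ) (h : ∃ ρ, k ρ ≠ 0) {ν : Fin d} (hν : ((low k h : Fin d) : ℕ) < ν) :
    ladderLen k ν = ladderLen (pred' k h) ν + 1 := by
  unfold ladderLen
  conv_lhs => rw [← pred'_add_single k h]
  simp only [Pi.add_apply]
  rw [Finset.sum_add_distrib, Finset.sum_pi_single',
    if_pos (show low k h ∈ univ.filter (fun ρ : Fin d => (ρ : ℕ) < ν) from
      Finset.mem_filter.2 ⟨Finset.mem_univ _, hν⟩)]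

/-- [cite: Balaban1985RegularSpaces, Lemma 1 (1.24)–(1.26) p. 79] THE COUNT `C_P = (d−1)(L−1)`: inside the block (all
offsets `< L`) a ladder has at most `(d−1)(L−1)` squares ("|V′_b − 1| < (d−1)(L−1)2α₀L⁻² for b ⊂ B(y)"). [folklore] -/
theorem ladderLen_le {L : ℕ} {k : Fin d → ℕ} (hk : ∀ κ, k κ < L) (ν : Fin d) :
    (ladderLen k ν : ℝ) ≤ ((d : ℝ) - 1) * ((L : ℝ) - 1) := by
  unfold ladderLen
  set F := univ.filter (fun ρ : Fin d => (ρ : ℕ) < ν) with hF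
  have hd : 1 ≤ d := by have := ν.isLt; omega
  have hL : 1 ≤ L := by have := hk ν; omega
  have hcard : F.card ≤ d - 1 := by
    have hsub : F ⊆ univ.erase ν := by
      intro ρ hρ
      rw [hF, Finset.mem_filter] at hρ
      rw [Finset.mem_erase]
      exact ⟨by intro h'; rw [h'] at hρ; exact lt_irrefl _ hρ.2, Finset.mem_univ _⟩
    have h1 := Finset.card_le_card hsub
    rwa [Finset.card_erase_of_mem (Finset.mem_univ ν), Finset.card_univ, Fintype.card_fin] at h1
  have hsum : ∑ ρ ∈ F, k ρ ≤ F.card * (L - 1) := by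
    have := Finset.sum_le_card_nsmul F k (L - 1) (fun ρ _ => by have := hk ρ; omega)
    simpa using this
  have h2 : ∑ ρ ∈ F, k ρ ≤ (d - 1) * (L - 1) := hsum.trans (Nat.mul_le_mul_right _ hcard)
  have h3 : ((∑ ρ ∈ F, k ρ : ℕ) : ℝ) ≤ (((d - 1) * (L - 1) : ℕ) : ℝ) := by exact_mod_cast h2
  rw [Nat.cast_mul, Nat.cast_sub hd, Nat.cast_sub hL] at h3
  simpa using h3

/-- [folklore] `|k|₁ ≤ d·(L−1)` inside the block (the length of a tree path). -/
theorem sum_le {L : ℕ} {k : Fin d → ℕ} (hk : ∀ κ, k κ < L) :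
    ((∑ ρ, k ρ : ℕ) : ℝ) ≤ (d : ℝ) * ((L : ℝ) - 1) := by
  have hsum : ∑ ρ, k ρ ≤ d * (L - 1) := by
    have := Finset.sum_le_card_nsmul (univ : Finset (Fin d)) k (L - 1) (fun ρ _ => by have := hk ρ; omega)
    simpa using this
  rcases Nat.eq_zero_or_pos d with hd | hd
  · subst hd; simp
  have hL : 1 ≤ L := by have := hk ⟨0, hd⟩; omega
  have h3 : ((∑ ρ, k ρ : ℕ) : ℝ) ≤ ((d * (L - 1) : ℕ) : ℝ) := by exact_mod_cast hsum
  rw [Nat.cast_mul, Nat.cast_sub hL] at h3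
  simpa using h3

/-- [folklore] A bound `F(y; ρ, ν) ≤ b` over the plaquettes `(y; ρ, ν)`, `ρ ≠ ν`, with all four corners in the block
`B(z) = z + {0,…,L−1}^d` (the quantifier shape of `B8Lemma1Lattice.PlaqBound`). -/
def PlaqSup (L : ℕ) (z : Site d) (F : Site d → Fin d → Fin d → ℝ) (b : ℝ) : Prop :=
  ∀ y : Site d, ∀ ρ ν : Fin d, ρ ≠ ν → InBlock L z y → InBlock L z (y + e ρ) → InBlock L z (y + e ν) →
    InBlock L z (y + e ρ + e ν) → F y ρ ν ≤ b

/-- [cite: Balaban1985RegularSpaces, Lemma 1 (1.24)–(1.26) p. 79] THE MASTER COUNT in the comb gauge: if every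
square of the block has GAUGE-FIXED relative plaquette deviation `‖plaq(U₁^g) − plaq U₀‖ ≤ s`, then every interior
bond `⟨z+k, z+k+e_ν⟩` (`z+k, z+k+e_ν ∈ B(z)`) has transverse defect `‖W − 1‖ ≤ (Σ_{ρ<ν} k_ρ)·s` — induction on the
ladder length, one `norm_defect_rung_le` per square, starting from the tree bond at the top of the ladder. [folklore] -/
theorem norm_defect_sub_one_le_ladderLen [NormOneClass R] {U₀ U₁ : Cfg d R} {z : Site d} {L : ℕ} {s : ℝ}
    (hU₀ : ∀ x ν, UnitaryLike (U₀ x ν)) (hU₁ : ∀ x ν, UnitaryLike (U₁ x ν))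
    (hs : PlaqSup L z (fun y ρ ν =>
      ‖(plaq (gaugeAct (combGauge U₀ U₁ z) U₁) y ρ ν : R) - plaq U₀ y ρ ν‖) s) :
    ∀ k : Fin d → ℕ, (∀ κ, k κ < L) → ∀ ν : Fin d, k ν + 1 < L →
      ‖(defect U₀ U₁ z (site z k) ν : R) - 1‖ ≤ (ladderLen k ν : ℝ) * s := by
  intro k hk ν hν
  suffices H : ∀ N (k : Fin d → ℕ), ladderLen k ν = N → (∀ κ, k κ < L) → k ν + 1 < L →
      ‖(defect U₀ U₁ z (site z k) ν : R) - 1‖ ≤ (N : ℝ) * s from H _ k rfl hk hν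
  intro N
  induction N with
  | zero =>
      intro k hN _ _
      rw [defect_tree U₀ U₁ z (isTree_of_ladderLen_eq_zero hN)]; simp
  | succ N ih =>
      intro k hN hkL hνL
      obtain ⟨ρ₁, hρ₁, hkρ₁⟩ : ∃ ρ ∈ univ.filter (fun ρ : Fin d => (ρ : ℕ) < ν), k ρ ≠ 0 :=
        Finset.exists_ne_zero_of_sum_ne_zero (by unfold ladderLen at hN; omega)
      have h : ∃ ρ, k ρ ≠ 0 := ⟨ρ₁, hkρ₁⟩
      have hν : ((low k h : Fin d) : ℕ) < ν :=
        lt_of_le_of_lt (show ((low k h : Fin d) : ℕ) ≤ ρ₁ from low_le k h hkρ₁) (by simpa using hρ₁)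
      have hneν : ν ≠ low k h := by intro h'; rw [← h'] at hν; exact lt_irrefl _ hν
      have hpL : ∀ κ, pred' k h κ < L := fun κ => (pred'_le k h κ).trans_lt (hkL κ)
      have hpν : pred' k h ν + 1 < L := by rw [pred'_apply_of_ne k h hneν]; exact hνL
      have hN' : ladderLen (pred' k h) ν = N := by have := ladderLen_eq_succ k h hν; omega
      have hstep : ‖(plaq (gaugeAct (combGauge U₀ U₁ z) U₁) (site z (pred' k h)) (low k h) ν : R) -
          plaq U₀ (site z (pred' k h)) (low k h) ν‖ ≤ s := by
        have hx : site z (pred' k h) + e (low k h) = site z k := by rw [← site_add_single, pred'_add_single]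
        apply hs _ _ _ (fun h' => hneν h'.symm)
        · exact (inBlock_site_iff L z _).2 hpL
        · rw [hx]; exact (inBlock_site_iff L z _).2 hkL
        · rw [← site_add_single]; exact (inBlock_site_iff L z _).2 (lt_of_add_single hpL hpν)
        · rw [hx, ← site_add_single]; exact (inBlock_site_iff L z _).2 (lt_of_add_single hkL hνL)
      calc ‖(defect U₀ U₁ z (site z k) ν : R) - 1‖
          ≤ ‖(defect U₀ U₁ z (site z (pred' k h)) ν : R) - 1‖ +
              ‖(plaq (gaugeAct (combGauge U₀ U₁ z) U₁) (site z (pred' k h)) (low k h) ν : R) -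
                plaq U₀ (site z (pred' k h)) (low k h) ν‖ := norm_defect_rung_le hU₀ hU₁ z k h ν hν
        _ ≤ (N : ℝ) * s + s := add_le_add (ih _ hN' hpL hpν) hstep
        _ = ((N + 1 : ℕ) : ℝ) * s := by push_cast; ring

/-- [folklore] THE FINE per-square input: `‖plaq(U₁^g)(y) − plaq U₀(y)‖ ≤ p + 2·t·q` from the RAW relative plaquette
deviation `p`, the base curvature `q` and the transport size `t` of the comb gauge on the block — `plaq_gaugeAct` and
the commutator cross term `T4RelativeLadder.norm_conj_sub_le`. -/
theorem plaqSup_fine [NormOneClass R] {U₀ U₁ : Cfg d R} {z : Site d} {L : ℕ} {p q t : ℝ}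
    (hU₀ : ∀ x ν, UnitaryLike (U₀ x ν)) (hU₁ : ∀ x ν, UnitaryLike (U₁ x ν))
    (hp : PlaqSup L z (fun y ρ ν => ‖(plaq U₁ y ρ ν : R) - plaq U₀ y ρ ν‖) p)
    (hq : PlaqSup L z (fun y ρ ν => ‖(plaq U₀ y ρ ν : R) - 1‖) q)
    (ht : ∀ y, InBlock L z y → ‖(combGauge U₀ U₁ z y : R) - 1‖ ≤ t) :
    PlaqSup L z (fun y ρ ν => ‖(plaq (gaugeAct (combGauge U₀ U₁ z) U₁) y ρ ν : R) - plaq U₀ y ρ ν‖)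
      (p + 2 * t * q) := by
  intro y ρ ν hρν h1 h2 h3 h4
  have hg := unitaryLike_combGauge hU₀ hU₁ z y
  show ‖(plaq (gaugeAct (combGauge U₀ U₁ z) U₁) y ρ ν : R) - plaq U₀ y ρ ν‖ ≤ _
  rw [plaq_gaugeAct, Units.val_mul, Units.val_mul]
  calc _ ≤ ‖(plaq U₁ y ρ ν : R) - plaq U₀ y ρ ν‖ + 2 * ‖(combGauge U₀ U₁ z y : R) - 1‖ * ‖(plaq U₀ y ρ ν : R) - 1‖ :=
        norm_conj_sub_le hg _ _
    _ ≤ p + 2 * t * q := by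
        have := hp y ρ ν hρν h1 h2 h3 h4
        have := hq y ρ ν hρν h1 h2 h3 h4
        have := ht y h1
        have : 0 ≤ ‖(plaq U₀ y ρ ν : R) - 1‖ := norm_nonneg _
        have : 0 ≤ ‖(combGauge U₀ U₁ z y : R) - 1‖ := norm_nonneg _
        nlinarith

/-- [cite: Balaban1985RegularSpaces, Lemma 1 (1.24)–(1.26) p. 79] THE CRUDE per-square input, the mechanism of (1.26)
"|(∂_{V₀}V′)(p) − 1| ≦ |V₀(∂p) − 1| + |(V′V₀)(∂p) − 1|": `‖plaq(U₁^g)(y) − plaq U₀(y)‖ ≤ q₁ + q₀` from the two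
curvature bounds alone (conjugation isometry; no transport bound needed). [folklore] -/
theorem plaqSup_crude [NormOneClass R] {U₀ U₁ : Cfg d R} {z : Site d} {L : ℕ} {q₀ q₁ : ℝ}
    (hU₀ : ∀ x ν, UnitaryLike (U₀ x ν)) (hU₁ : ∀ x ν, UnitaryLike (U₁ x ν))
    (hq₁ : PlaqSup L z (fun y ρ ν => ‖(plaq U₁ y ρ ν : R) - 1‖) q₁)
    (hq₀ : PlaqSup L z (fun y ρ ν => ‖(plaq U₀ y ρ ν : R) - 1‖) q₀) :
    PlaqSup L z (fun y ρ ν => ‖(plaq (gaugeAct (combGauge U₀ U₁ z) U₁) y ρ ν : R) - plaq U₀ y ρ ν‖) (q₁ + q₀) := by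
  intro y ρ ν hρν h1 h2 h3 h4
  have hg := unitaryLike_combGauge hU₀ hU₁ z y
  show ‖(plaq (gaugeAct (combGauge U₀ U₁ z) U₁) y ρ ν : R) - plaq U₀ y ρ ν‖ ≤ _
  rw [plaq_gaugeAct, Units.val_mul, Units.val_mul]
  calc ‖(combGauge U₀ U₁ z y : R) * (plaq U₁ y ρ ν : R) * ↑(combGauge U₀ U₁ z y)⁻¹ - plaq U₀ y ρ ν‖
      ≤ ‖(combGauge U₀ U₁ z y : R) * (plaq U₁ y ρ ν : R) * ↑(combGauge U₀ U₁ z y)⁻¹ - 1‖ +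
          ‖(1 : R) - plaq U₀ y ρ ν‖ := norm_sub_le_norm_sub_add_norm_sub _ _ _
    _ = ‖(plaq U₁ y ρ ν : R) - 1‖ + ‖(plaq U₀ y ρ ν : R) - 1‖ := by
        rw [norm_conj_sub_one_eq hg, norm_sub_rev (1 : R)]
    _ ≤ q₁ + q₀ := add_le_add (hq₁ y ρ ν hρν h1 h2 h3 h4) (hq₀ y ρ ν hρν h1 h2 h3 h4)

/-! ## §4  The packaged statements: the relative comb gauge on a block, `C_P = (d−1)(L−1)` -/

/-- [folklore] Transport size of the comb gauge on the block: `‖g(y) − 1‖ ≤ d(L−1)·ε` for `y ∈ B(z)`. -/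
theorem norm_combGauge_sub_one_le [NormOneClass R] {U₀ U₁ : Cfg d R} {z : Site d} {L : ℕ} {ε : ℝ}
    (hU₀ : ∀ x ν, UnitaryLike (U₀ x ν)) (hU₁ : ∀ x ν, ‖(U₁ x ν : R)‖ ≤ 1) (hε : 0 ≤ ε)
    (hdev : ∀ x ν, InBlock L z x → InBlock L z (x + e ν) → ‖(U₁ x ν : R) - U₀ x ν‖ ≤ ε)
    (y : Site d) (hy : InBlock L z y) : ‖(combGauge U₀ U₁ z y : R) - 1‖ ≤ (d : ℝ) * ((L : ℝ) - 1) * ε := by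
  obtain ⟨k, hk, rfl⟩ := exists_offset_of_inBlock hy
  rw [combGauge_site]
  calc _ ≤ ((∑ ρ, k ρ : ℕ) : ℝ) * ε := norm_relGauge_sub_one_le hU₀ hU₁ hdev k hk
    _ ≤ (d : ℝ) * ((L : ℝ) - 1) * ε := mul_le_mul_of_nonneg_right (sum_le hk) hε

/-- [cite: Balaban1985RegularSpaces, Lemma 1 (1.24)–(1.26) p. 79] THE CRUDE INTERIOR BOUND, NON-ABELIAN — the printed
shape of (1.26) and the sentence after it: if BOTH configurations have curvature `≤ q₀`, `≤ q₁` on the squares of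
`B(z)` then in the relative comb gauge they differ on every interior bond by `‖(U₁^g)·U₀⁻¹ − 1‖ ≤ (d−1)(L−1)·(q₁ + q₀)`
("|V′_b − 1| < (d−1)(L−1)2α₀L⁻² for b ⊂ B(y)" with `q₀ = q₁ = α₀L⁻²`).  The abelian model of exactly this count is
`B8Lemma1Lattice.interior_bound`. [folklore] -/
theorem interior_bound_crude [NormOneClass R] {U₀ U₁ : Cfg d R} {z : Site d} {L : ℕ} {q₀ q₁ : ℝ}
    (hU₀ : ∀ x ν, UnitaryLike (U₀ x ν)) (hU₁ : ∀ x ν, UnitaryLike (U₁ x ν))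
    (hq₁ : PlaqSup L z (fun y ρ ν => ‖(plaq U₁ y ρ ν : R) - 1‖) q₁)
    (hq₀ : PlaqSup L z (fun y ρ ν => ‖(plaq U₀ y ρ ν : R) - 1‖) q₀) (hq : 0 ≤ q₁ + q₀)
    (x : Site d) (ν : Fin d) (hx : InBlock L z x) (hxν : InBlock L z (x + e ν)) :
    ‖(defect U₀ U₁ z x ν : R) - 1‖ ≤ ((d : ℝ) - 1) * ((L : ℝ) - 1) * (q₁ + q₀) := by
  obtain ⟨k, hk, rfl⟩ := exists_offset_of_inBlock hx
  have hν : k ν + 1 < L := by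
    rw [← site_add_single, inBlock_site_iff] at hxν
    simpa using hxν ν
  calc _ ≤ (ladderLen k ν : ℝ) * (q₁ + q₀) :=
        norm_defect_sub_one_le_ladderLen hU₀ hU₁ (plaqSup_crude hU₀ hU₁ hq₁ hq₀) k hk ν hν
    _ ≤ ((d : ℝ) - 1) * ((L : ℝ) - 1) * (q₁ + q₀) := mul_le_mul_of_nonneg_right (ladderLen_le hk ν) hq

/-- [cite: Balaban1985RegularSpaces, Lemma 1 (1.24)–(1.26) p. 79] THE FINE INTERIOR BOUND, NON-ABELIAN, with the
commutator cross term displayed: raw relative plaquette deviation `≤ p`, base curvature `≤ q`, bond deviation `≤ ε`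
on `B(z)` give, in the relative comb gauge, `‖(U₁^g)·U₀⁻¹ − 1‖ ≤ (d−1)(L−1)·(p + 2·(d(L−1)ε)·q)` on every interior
bond — LINEAR in the block side with `C_P = (d−1)(L−1)`, second order in (transport × curvature).  This is the
sup-norm, one-block, lattice-geometric part of the cell's located obligation O-G1′ (GAPS G-ne1p1-1); nothing about
Hölder norms, block-wise patching across blocks, or Bałaban's window is asserted. [folklore] -/
theorem interior_bound_fine [NormOneClass R] {U₀ U₁ : Cfg d R} {z : Site d} {L : ℕ} {p q ε : ℝ}
    (hU₀ : ∀ x ν, UnitaryLike (U₀ x ν)) (hU₁ : ∀ x ν, UnitaryLike (U₁ x ν)) (hε : 0 ≤ ε)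
    (hdev : ∀ x ν, InBlock L z x → InBlock L z (x + e ν) → ‖(U₁ x ν : R) - U₀ x ν‖ ≤ ε)
    (hp : PlaqSup L z (fun y ρ ν => ‖(plaq U₁ y ρ ν : R) - plaq U₀ y ρ ν‖) p)
    (hq : PlaqSup L z (fun y ρ ν => ‖(plaq U₀ y ρ ν : R) - 1‖) q) (hpq : 0 ≤ p + 2 * ((d : ℝ) * ((L : ℝ) - 1) * ε) * q)
    (x : Site d) (ν : Fin d) (hx : InBlock L z x) (hxν : InBlock L z (x + e ν)) :
    ‖(defect U₀ U₁ z x ν : R) - 1‖ ≤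
      ((d : ℝ) - 1) * ((L : ℝ) - 1) * (p + 2 * ((d : ℝ) * ((L : ℝ) - 1) * ε) * q) := by
  obtain ⟨k, hk, rfl⟩ := exists_offset_of_inBlock hx
  have hν : k ν + 1 < L := by
    rw [← site_add_single, inBlock_site_iff] at hxν
    simpa using hxν ν
  have ht := norm_combGauge_sub_one_le hU₀ (fun x ν => (hU₁ x ν).1) hε hdev
  calc _ ≤ (ladderLen k ν : ℝ) * (p + 2 * ((d : ℝ) * ((L : ℝ) - 1) * ε) * q) :=
        norm_defect_sub_one_le_ladderLen hU₀ hU₁ (plaqSup_fine hU₀ hU₁ hp hq ht) k hk ν hν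
    _ ≤ _ := mul_le_mul_of_nonneg_right (ladderLen_le hk ν) hpq

/-- [cite: Balaban1985Averaging, (44)–(47) pp. 24–25] THE FLAT CASE `U₀ ≡ 1` = THE PRINTED AXIAL-GAUGE SENTENCE,
NON-ABELIAN, on the lattice: if `‖U(∂p) − 1‖ ≤ α` on the squares of `B(z)` then in the axial (comb) gauge from `z`
every interior bond satisfies `‖(U^g)⟨z+k, z+k+e_ν⟩ − 1‖ ≤ (Σ_{ρ<ν} k_ρ)·α` — "|V₀(x, x + e_μ) − 1| < (|x₁ − y₁| + … +
|x_{μ−1} − y_{μ−1}|)α₀" (up to the relabelling of coordinates of `B8Lemma1Lattice`'s `d`-first convention).  The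
abstract `ℕ`-indexed chain of this sentence is `T4AxialChain.norm_oprod_sub_one_le_mul` (`m·α₀`); here `m` IS the
lattice ladder length. [folklore] -/
theorem axial_bound [NormOneClass R] {U : Cfg d R} {z : Site d} {L : ℕ} {α : ℝ}
    (hU : ∀ x ν, UnitaryLike (U x ν)) (hα : PlaqSup L z (fun y ρ ν => ‖(plaq U y ρ ν : R) - 1‖) α)
    (k : Fin d → ℕ) (hk : ∀ κ, k κ < L) (ν : Fin d) (hν : k ν + 1 < L) :
    ‖(gaugeAct (combGauge (fun _ _ => 1) U z) U (site z k) ν : R) - 1‖ ≤ (ladderLen k ν : ℝ) * α := by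
  have h1 : ∀ (x : Site d) (ν : Fin d), UnitaryLike ((fun _ _ => (1 : Rˣ)) x ν) := fun _ _ => UnitaryLike.one
  have h0 : PlaqSup L z (fun y ρ ν => ‖(plaq (fun _ _ => (1 : Rˣ)) y ρ ν : R) - 1‖) 0 := by
    intro y ρ ν _ _ _ _ _; simp [plaq]
  have := norm_defect_sub_one_le_ladderLen h1 hU (plaqSup_crude h1 hU hα h0) k hk ν hν
  simpa [defect] using this

/-- [folklore] In the flat case the comb gauge is the axial gauge: `(U^g) = 1` on every tree bond
("V₀(Γ_{y,x}) = 1"). -/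
theorem axial_tree {U : Cfg d R} (z : Site d) {k : Fin d → ℕ} {ρ : Fin d} (hk : IsTree k ρ) :
    gaugeAct (combGauge (fun _ _ => 1) U z) U (site z k) ρ = 1 :=
  gaugeAct_combGauge_tree _ U z hk

/-- [cite: Balaban1985RegularSpaces, Lemma 1 (1.24)–(1.26) p. 79] THE RELATIVE COMB GAUGE ON A BLOCK, packaged (the
shape wanted by GAPS G-ne1p1-1 in sup norm, one block, `C_P(L) = (d−1)(L−1)`): for unitary-like `U₀, U₁` on `ℤ^d`
there is a unitary-like gauge `g` on `ℤ^d` (namely `combGauge U₀ U₁ z`) with `g(z) = 1`, `U₁^g = U₀` on every tree bond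
of the staircase trees from `z`, `‖g − 1‖ ≤ d(L−1)ε` on `B(z)`, and `U₁^g = W·U₀` with `‖W − 1‖ ≤ (d−1)(L−1)·(p +
2d(L−1)εq)` on every interior bond of `B(z)`. [folklore] -/
theorem relative_comb_gauge [NormOneClass R] {U₀ U₁ : Cfg d R} (z : Site d) {L : ℕ} {p q ε : ℝ}
    (hU₀ : ∀ x ν, UnitaryLike (U₀ x ν)) (hU₁ : ∀ x ν, UnitaryLike (U₁ x ν)) (hε : 0 ≤ ε)
    (hdev : ∀ x ν, InBlock L z x → InBlock L z (x + e ν) → ‖(U₁ x ν : R) - U₀ x ν‖ ≤ ε)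
    (hp : PlaqSup L z (fun y ρ ν => ‖(plaq U₁ y ρ ν : R) - plaq U₀ y ρ ν‖) p)
    (hq : PlaqSup L z (fun y ρ ν => ‖(plaq U₀ y ρ ν : R) - 1‖) q) (hpq : 0 ≤ p + 2 * ((d : ℝ) * ((L : ℝ) - 1) * ε) * q) :
    ∃ g : Site d → Rˣ,
      g z = 1 ∧ (∀ x, UnitaryLike (g x)) ∧
      (∀ (k : Fin d → ℕ) (ρ : Fin d), IsTree k ρ → gaugeAct g U₁ (site z k) ρ = U₀ (site z k) ρ) ∧
      (∀ y, InBlock L z y → ‖(g y : R) - 1‖ ≤ (d : ℝ) * ((L : ℝ) - 1) * ε) ∧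
      (∀ x ν, InBlock L z x → InBlock L z (x + e ν) →
        ‖((gaugeAct g U₁ x ν * (U₀ x ν)⁻¹ : Rˣ) : R) - 1‖ ≤
          ((d : ℝ) - 1) * ((L : ℝ) - 1) * (p + 2 * ((d : ℝ) * ((L : ℝ) - 1) * ε) * q)) :=
  ⟨combGauge U₀ U₁ z, combGauge_corner U₀ U₁ z, unitaryLike_combGauge hU₀ hU₁ z,
    fun _ _ hk => gaugeAct_combGauge_tree U₀ U₁ z hk,
    norm_combGauge_sub_one_le hU₀ (fun x ν => (hU₁ x ν).1) hε hdev,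
    fun x ν hx hxν => interior_bound_fine hU₀ hU₁ hε hdev hp hq hpq x ν hx hxν⟩

/-! ## §5  Non-vacuity -/

/-- [folklore] The hypotheses of `relative_comb_gauge` are jointly satisfiable (flat pair over `ℝ`, any block), and the
conclusion then pins the defect: `W = 1`. -/
example (d L : ℕ) (z : Site d) (x : Site d) (ν : Fin d) (hx : InBlock L z x) (hxν : InBlock L z (x + e ν)) :
    ‖(defect (fun _ _ => (1 : ℝˣ)) (fun _ _ => (1 : ℝˣ)) z x ν : ℝ) - 1‖ ≤ 0 := by
  have hU : ∀ (x : Site d) (ν : Fin d), UnitaryLike ((fun _ _ => (1 : ℝˣ)) x ν) := fun _ _ => UnitaryLike.one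
  have h := interior_bound_crude (L := L) (z := z) (q₀ := 0) (q₁ := 0) hU hU
    (by intro y ρ ν _ _ _ _ _; simp [plaq]) (by intro y ρ ν _ _ _ _ _; simp [plaq]) (by norm_num) x ν hx hxν
  simpa using h

end Literature.MathematicalPhysics.QuantumFieldTheory.Balaban1983to89.T4RelativeComb
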